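import Summits.CriticalPhenomena.CardyFormulaZ2.Theorems.CardyFlipRussoVoronoiHubFromSmirnovCountTail
import Summits.CriticalPhenomena.CardyFormulaZ2.Theorems.CardyFlipRussoVoronoiHubFromSmirnovGridNet
import Summits.CriticalPhenomena.CardyFormulaZ2.Theorems.CardyFlipRussoVoronoiHubFromSmirnovVoidBall

/-!
# Stub `poisson_navelTie_le` of line `moebius-exact-delaunay-dilation-ward`
# (crux `VoronoiHubFromSmirnov`, stmt-CriticalPhenomena-6433)

Near-tied navel configurations ("potential defects") are rare for a planar Poisson process of
bounded intensity (I. Benjamini, O. Schramm, *Conformal invariance of Voronoi percolation*,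
Comm. Math. Phys. 197 (1998) 75–107, Prop. 5.3 / Thm 5.6). A *navel tie* of a configuration `c`
is a centre `x ∈ closedBall 0 ρ`, two distinct nuclei `p, q ∈ c` at a common distance
`r = dist p x = dist q x ≤ ℓ` from `x`, and two further distinct nuclei `a, b ∈ c` TIED at a
common distance `dist a x = dist b x ∈ [r, r + τ)`. If the intensity `μ` of the Poisson process
`P` is at most `M₀ ·` Lebesgue, then for `0 < τ ≤ ℓ ≤ ρ`
`P(some navel tie) ≤ (4ρ/τ + 1)² · (4ℓ/τ) · (36 π M₀ τ ℓ)⁴ / 24`.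

Proof (discretised navels, no Jacobians). Round the centre `x` to a point `x₀` of a `τ`-net `X`
of `closedBall 0 ρ` (`exists_finset_net_closedBall`, `|X| ≤ (4ρ/τ + 1)²`, `dist x x₀ < τ`) and
the radius `r` down to `r₀ := τ ⌊r/τ⌋₊` (`0 ≤ r - r₀ < τ`, index `⌊r/τ⌋₊ ≤ ⌊ℓ/τ⌋₊`, at most
`⌊ℓ/τ⌋₊ + 1 ≤ 4ℓ/τ` radii). All four nuclei `y ∈ {p, q, a, b}` have `dist y x ∈ [r, r + τ)`,
hence `dist y x₀ ∈ (r - τ, r + 2τ) ⊆ (r₀ - τ, r₀ + 3τ)` (triangle inequality), i.e. they lie in the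
annulus `A(x₀, r₀) := ball x₀ (r₀ + 3τ) \ closedBall x₀ (r₀ - τ)`, so `N(A(x₀, r₀)) ≥ 4`. The union
bound over the `|X| · (⌊ℓ/τ⌋₊ + 1)` annuli (`measureReal_biUnion_finset_le`) and the Poisson
count tail `P(N(A) ≥ 4) ≤ μ(A)⁴ / 4!` (`poisson_count_tail_le`) with
`μ(A) ≤ M₀ |A| ≤ M₀ · 36 π τ ℓ` (`|A| = π((r₀ + 3τ)² - (r₀ - τ)²) = 8πτ(r₀ + τ) ≤ 16 π τ ℓ` if
`r₀ ≥ τ`, and `|A| ≤ π (3τ)²` if `r₀ = 0`; `Complex.volume_ball`, `measure_sdiff`) finish the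
estimate.

No new definitions; tree facts and Mathlib only.
-/

noncomputable section

namespace Summit.CriticalPhenomena.CardyFormulaZ2.Cruxes.VoronoiHubFromSmirnov.MoebiusExactDelaunayDilationWard

open MeasureTheory Literature.Analysis.FunctionSpaces
open scoped ENNReal NNReal

/-! ### Counting four distinct points -/

/-- Four pairwise distinct points form a set of extended cardinality `4`. -/
theorem nt_encard_four_eq {α : Type*} {p q a b : α} (hpq : p ≠ q) (hab : a ≠ b) (hap : a ≠ p)
    (haq : a ≠ q) (hbp : b ≠ p) (hbq : b ≠ q) :
    ({p, q, a, b} : Set α).encard = 4 := by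
  have hp : p ∉ ({q, a, b} : Set α) := by
    simp only [Set.mem_insert_iff, Set.mem_singleton_iff, not_or]
    exact ⟨hpq, fun h => hap h.symm, fun h => hbp h.symm⟩
  have hq : q ∉ ({a, b} : Set α) := by
    simp only [Set.mem_insert_iff, Set.mem_singleton_iff, not_or]
    exact ⟨fun h => haq h.symm, fun h => hbq h.symm⟩
  rw [Set.encard_insert_of_notMem hp, Set.encard_insert_of_notMem hq, Set.encard_pair hab]
  norm_num

/-- Four pairwise distinct points of a configuration `c` lying in a region `A` force
`N_c(A) ≥ 4`. -/
theorem nt_four_le_count (c : PointConfig ℂ) (A : Set ℂ) {p q a b : ℂ} (hp : p ∈ c) (hq : q ∈ c)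
    (ha : a ∈ c) (hb : b ∈ c) (hpA : p ∈ A) (hqA : q ∈ A) (haA : a ∈ A) (hbA : b ∈ A)
    (hpq : p ≠ q) (hab : a ≠ b) (hap : a ≠ p) (haq : a ≠ q) (hbp : b ≠ p) (hbq : b ≠ q) :
    ((4 : ℕ) : ℕ∞) ≤ c.count A := by
  have hsub : ({p, q, a, b} : Set ℂ) ⊆ c.carrier ∩ A := by
    intro y hy
    simp only [Set.mem_insert_iff, Set.mem_singleton_iff] at hy
    rcases hy with rfl | rfl | rfl | rfl
    exacts [⟨hp, hpA⟩, ⟨hq, hqA⟩, ⟨ha, haA⟩, ⟨hb, hbA⟩]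
  calc ((4 : ℕ) : ℕ∞) = ({p, q, a, b} : Set ℂ).encard := by
        rw [nt_encard_four_eq hpq hab hap haq hbp hbq]; rfl
    _ ≤ (c.carrier ∩ A).encard := Set.encard_le_encard hsub

/-! ### The discretised annulus -/

/-- Rounding geometry: if `dist x x₀ < τ`, `s ≤ r < s + τ` and `dist y x ∈ [r, r + τ)`, then
`y` lies in the annulus `ball x₀ (s + 3τ) \ closedBall x₀ (s - τ)` (triangle inequality). -/
theorem nt_mem_annulus {x x₀ y : ℂ} {r s τ : ℝ} (hxx₀ : dist x x₀ < τ) (hsr : s ≤ r)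
    (hrs : r < s + τ) (hy1 : r ≤ dist y x) (hy2 : dist y x < r + τ) :
    y ∈ Metric.ball x₀ (s + 3 * τ) \ Metric.closedBall x₀ (s - τ) := by
  have h1 : dist y x₀ ≤ dist y x + dist x x₀ := dist_triangle y x x₀
  have h2 : dist y x ≤ dist y x₀ + dist x₀ x := dist_triangle y x₀ x
  have h3 : dist x₀ x = dist x x₀ := dist_comm x₀ x
  refine ⟨?_, ?_⟩
  · rw [Metric.mem_ball]
    linarith
  · rw [Metric.mem_closedBall, not_le]
    linarith

/-- **Deterministic inclusion.** If `closedBall 0 ρ` is covered by the `τ`-balls centred at the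
points of `X`, then every configuration with a navel tie (centre `x ∈ closedBall 0 ρ`, radius
`r ≤ ℓ`, tie window `[r, r + τ)`) has at least four nuclei in one of the discretised annuli
`ball x₀ (jτ + 3τ) \ closedBall x₀ (jτ - τ)`, `x₀ ∈ X`, `j ≤ ⌊ℓ/τ⌋₊` (take `dist x x₀ < τ` and
`j := ⌊r/τ⌋₊`). -/
theorem nt_navelTie_subset (X : Finset ℂ) {ρ ℓ τ : ℝ} (hτ : 0 < τ)
    (hX : Metric.closedBall (0 : ℂ) ρ ⊆ ⋃ x ∈ X, Metric.ball x τ) :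
    {c : PointConfig ℂ | ∃ (x p q a b : ℂ), p ∈ c ∧ q ∈ c ∧ a ∈ c ∧ b ∈ c ∧ p ≠ q ∧ a ≠ b ∧
        a ≠ p ∧ a ≠ q ∧ b ≠ p ∧ b ≠ q ∧ x ∈ Metric.closedBall (0 : ℂ) ρ ∧ dist p x = dist q x ∧
        dist p x ≤ ℓ ∧ dist a x = dist b x ∧ dist p x ≤ dist a x ∧ dist a x < dist p x + τ} ⊆
      ⋃ x₀ ∈ X, ⋃ j ∈ Finset.range (⌊ℓ / τ⌋₊ + 1), {c : PointConfig ℂ | ((4 : ℕ) : ℕ∞) ≤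
        c.count (Metric.ball x₀ ((j : ℝ) * τ + 3 * τ) \ Metric.closedBall x₀ ((j : ℝ) * τ - τ))} := by
  rintro c ⟨x, p, q, a, b, hp, hq, ha, hb, hpq, hab, hap, haq, hbp, hbq, hx, hpqx, hpℓ, habx,
    hpa, haτ⟩
  obtain ⟨x₀, hx₀X, hxx₀⟩ := Set.mem_iUnion₂.mp (hX hx)
  rw [Metric.mem_ball] at hxx₀
  set r : ℝ := dist p x with hr
  have hr0 : 0 ≤ r := dist_nonneg
  have hrτ0 : 0 ≤ r / τ := div_nonneg hr0 hτ.le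
  set j : ℕ := ⌊r / τ⌋₊ with hj
  have hj1 : (j : ℝ) ≤ r / τ := Nat.floor_le hrτ0
  have hj2 : r / τ < j + 1 := Nat.lt_floor_add_one _
  have hsr : (j : ℝ) * τ ≤ r := by
    have h := mul_le_mul_of_nonneg_right hj1 hτ.le
    rwa [div_mul_cancel₀ _ hτ.ne'] at h
  have hrs : r < (j : ℝ) * τ + τ := by
    have h := mul_lt_mul_of_pos_right hj2 hτ
    rw [div_mul_cancel₀ _ hτ.ne'] at h
    linarith
  refine Set.mem_iUnion₂.mpr ⟨x₀, hx₀X, Set.mem_iUnion₂.mpr ⟨j, ?_, ?_⟩⟩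
  · rw [Finset.mem_range, Nat.lt_add_one_iff]
    exact Nat.floor_le_floor (div_le_div_of_nonneg_right hpℓ hτ.le)
  · exact nt_four_le_count c _ hp hq ha hb
      (nt_mem_annulus hxx₀ hsr hrs le_rfl (by linarith))
      (nt_mem_annulus hxx₀ hsr hrs hpqx.le (by linarith))
      (nt_mem_annulus hxx₀ hsr hrs hpa haτ)
      (nt_mem_annulus hxx₀ hsr hrs (habx ▸ hpa) (habx ▸ haτ))
      hpq hab hap haq hbp hbq

/-! ### Area of the discretised annulus -/

/-- The area of a closed planar disc of radius `r ≥ 0`, as a real number: `|closedBall x r| = π r²`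
(`Complex.volume_closedBall`). -/
theorem nt_volume_closedBall_toReal (x : ℂ) {r : ℝ} (hr : 0 ≤ r) :
    (volume (Metric.closedBall x r)).toReal = Real.pi * r ^ 2 := by
  rw [Complex.volume_closedBall, ← Complex.volume_ball x]
  exact vb_volume_ball_toReal x hr

/-- Area bound for the discretised annulus: for `0 ≤ s ≤ ℓ` and `0 < τ ≤ ℓ`,
`|ball x₀ (s + 3τ) \ closedBall x₀ (s - τ)| ≤ 36 π τ ℓ` (if `s < τ` the region lies in a disc of
radius `4τ`; if `τ ≤ s` it is an honest annulus of area `π((s + 3τ)² - (s - τ)²) = 8πτ(s + τ)`). -/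
theorem nt_volume_annulus_toReal_le (x₀ : ℂ) {s τ ℓ : ℝ} (hτ : 0 < τ) (hτℓ : τ ≤ ℓ) (hs0 : 0 ≤ s)
    (hsℓ : s ≤ ℓ) :
    (volume (Metric.ball x₀ (s + 3 * τ) \ Metric.closedBall x₀ (s - τ))).toReal ≤
      36 * Real.pi * τ * ℓ := by
  have hτℓ' : τ * τ ≤ τ * ℓ := mul_le_mul_of_nonneg_left hτℓ hτ.le
  have hτℓ0 : 0 ≤ τ * ℓ := mul_nonneg hτ.le (hτ.le.trans hτℓ)
  rcases lt_or_ge s τ with hsτ | hτs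
  · have h2 : s + 3 * τ ≤ 4 * τ := by linarith
    have h3 : (s + 3 * τ) ^ 2 ≤ (4 * τ) ^ 2 := pow_le_pow_left₀ (by positivity) h2 2
    have h4 : (s + 3 * τ) ^ 2 ≤ 36 * τ * ℓ := by nlinarith
    calc (volume (Metric.ball x₀ (s + 3 * τ) \ Metric.closedBall x₀ (s - τ))).toReal
        ≤ (volume (Metric.ball x₀ (s + 3 * τ))).toReal :=
          ENNReal.toReal_mono measure_ball_lt_top.ne (measure_mono Set.sdiff_subset)
      _ = Real.pi * (s + 3 * τ) ^ 2 := vb_volume_ball_toReal x₀ (by positivity)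
      _ ≤ Real.pi * (36 * τ * ℓ) := mul_le_mul_of_nonneg_left h4 Real.pi_pos.le
      _ = 36 * Real.pi * τ * ℓ := by ring
  · have hsub : Metric.closedBall x₀ (s - τ) ⊆ Metric.ball x₀ (s + 3 * τ) :=
      Metric.closedBall_subset_ball (by linarith)
    rw [measure_sdiff hsub measurableSet_closedBall.nullMeasurableSet measure_closedBall_lt_top.ne,
      ENNReal.toReal_sub_of_le (measure_mono hsub) measure_ball_lt_top.ne,
      vb_volume_ball_toReal x₀ (by positivity), nt_volume_closedBall_toReal x₀ (by linarith)]
    have hsℓ' : s * τ ≤ ℓ * τ := mul_le_mul_of_nonneg_right hsℓ hτ.le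
    have h1 : 8 * s * τ + 8 * τ ^ 2 ≤ 36 * τ * ℓ := by nlinarith
    calc Real.pi * (s + 3 * τ) ^ 2 - Real.pi * (s - τ) ^ 2
        = Real.pi * (8 * s * τ + 8 * τ ^ 2) := by ring
      _ ≤ Real.pi * (36 * τ * ℓ) := mul_le_mul_of_nonneg_left h1 Real.pi_pos.le
      _ = 36 * Real.pi * τ * ℓ := by ring

/-! ### One annulus: the Poisson count tail -/

/-- **One discretised annulus.** For a Poisson process `P` of intensity `μ ≤ M₀ ·` Lebesgue and
`j ≤ ⌊ℓ/τ⌋₊` (`0 < τ ≤ ℓ`), the probability of at least four nuclei in the annulus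
`ball x₀ (jτ + 3τ) \ closedBall x₀ (jτ - τ)` is at most `(36 π M₀ τ ℓ)⁴ / 24`
(`poisson_count_tail_le` with `μ(annulus) ≤ M₀ · 36 π τ ℓ` and `4! = 24`). -/
theorem nt_annulus_term_le {μ : Measure ℂ} {P : Measure (PointConfig ℂ)} (M₀ : ℝ)
    (hP : IsPoissonPointProcess μ P) (hM₀ : 0 ≤ M₀)
    (hμ : ∀ S : Set ℂ, MeasurableSet S → μ S ≤ ENNReal.ofReal M₀ * volume S) {ℓ τ : ℝ}
    (hτ : 0 < τ) (hτℓ : τ ≤ ℓ) (x₀ : ℂ) {j : ℕ} (hj : j ∈ Finset.range (⌊ℓ / τ⌋₊ + 1)) :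
    P.real {c : PointConfig ℂ | ((4 : ℕ) : ℕ∞) ≤
        c.count (Metric.ball x₀ ((j : ℝ) * τ + 3 * τ) \ Metric.closedBall x₀ ((j : ℝ) * τ - τ))} ≤
      (36 * Real.pi * M₀ * τ * ℓ) ^ 4 / 24 := by
  set A : Set ℂ := Metric.ball x₀ ((j : ℝ) * τ + 3 * τ) \ Metric.closedBall x₀ ((j : ℝ) * τ - τ)
    with hA_def
  have hA : MeasurableSet A := measurableSet_ball.diff measurableSet_closedBall
  have hℓ0 : 0 ≤ ℓ := hτ.le.trans hτℓ
  have hs0 : 0 ≤ (j : ℝ) * τ := by positivity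
  have hsℓ : (j : ℝ) * τ ≤ ℓ := by
    have hj' : j ≤ ⌊ℓ / τ⌋₊ := by
      rw [Finset.mem_range, Nat.lt_add_one_iff] at hj
      exact hj
    have h1 : (j : ℝ) ≤ ℓ / τ :=
      (Nat.cast_le.mpr hj').trans (Nat.floor_le (div_nonneg hℓ0 hτ.le))
    have h2 := mul_le_mul_of_nonneg_right h1 hτ.le
    rwa [div_mul_cancel₀ _ hτ.ne'] at h2
  have hvolA : (volume A).toReal ≤ 36 * Real.pi * τ * ℓ :=
    nt_volume_annulus_toReal_le x₀ hτ hτℓ hs0 hsℓ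
  have hvolA_fin : volume A ≠ ⊤ :=
    ((measure_mono Set.sdiff_subset).trans_lt measure_ball_lt_top).ne
  have hM₀vol : ENNReal.ofReal M₀ * volume A ≠ ⊤ := ENNReal.mul_ne_top ENNReal.ofReal_ne_top hvolA_fin
  have hμA : μ A ≤ ENNReal.ofReal M₀ * volume A := hμ A hA
  have hμA_fin : μ A ≠ ⊤ := ne_top_of_le_ne_top hM₀vol hμA
  have hμA_real : (μ A).toReal ≤ M₀ * (36 * Real.pi * τ * ℓ) :=
    calc (μ A).toReal ≤ (ENNReal.ofReal M₀ * volume A).toReal := ENNReal.toReal_mono hM₀vol hμA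
      _ = M₀ * (volume A).toReal := by rw [ENNReal.toReal_mul, ENNReal.toReal_ofReal hM₀]
      _ ≤ M₀ * (36 * Real.pi * τ * ℓ) := mul_le_mul_of_nonneg_left hvolA hM₀
  have hfac : ((Nat.factorial 4 : ℕ) : ℝ) = 24 := by norm_num [Nat.factorial]
  calc P.real {c : PointConfig ℂ | ((4 : ℕ) : ℕ∞) ≤ c.count A}
      ≤ (μ A).toReal ^ 4 / ((Nat.factorial 4 : ℕ) : ℝ) := poisson_count_tail_le hP hA hμA_fin 4
    _ ≤ (M₀ * (36 * Real.pi * τ * ℓ)) ^ 4 / 24 := by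
        rw [hfac]
        exact div_le_div_of_nonneg_right
          (pow_le_pow_left₀ ENNReal.toReal_nonneg hμA_real 4) (by norm_num)
    _ = (36 * Real.pi * M₀ * τ * ℓ) ^ 4 / 24 := by ring

/-- The number of discretised radii: `⌊ℓ/τ⌋₊ + 1 ≤ ℓ/τ + 1 ≤ 4ℓ/τ` for `0 < τ ≤ ℓ`. -/
theorem nt_card_range_le {ℓ τ : ℝ} (hτ : 0 < τ) (hτℓ : τ ≤ ℓ) :
    ((Finset.range (⌊ℓ / τ⌋₊ + 1)).card : ℝ) ≤ 4 * ℓ / τ := by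
  rw [Finset.card_range, Nat.cast_add, Nat.cast_one]
  have h0 : 1 ≤ ℓ / τ := by rwa [le_div_iff₀ hτ, one_mul]
  have h1 : (⌊ℓ / τ⌋₊ : ℝ) ≤ ℓ / τ := Nat.floor_le (by linarith)
  have h2 : 4 * ℓ / τ = 4 * (ℓ / τ) := by ring
  linarith

/-! ### The estimate -/

/-- **Near-tied navels are rare** (Benjamini–Schramm 1998, Prop. 5.3 / Thm 5.6, discretised):
for a Poisson process `P` on `ℂ` whose intensity is at most `M₀ ·` Lebesgue and `0 < τ ≤ ℓ ≤ ρ`,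
the probability that some centre `x ∈ closedBall 0 ρ` carries two distinct nuclei `p, q` at a
common distance `r ≤ ℓ` and two further distinct nuclei `a, b` tied at a common distance in
`[r, r + τ)` is at most `(4ρ/τ + 1)² · (4ℓ/τ) · (36 π M₀ τ ℓ)⁴ / 24` (union bound over a
`τ`-net of centres and `⌊ℓ/τ⌋₊ + 1` discretised radii of the Poisson count tail in the annulus
that must contain all four nuclei). -/
theorem poisson_navelTie_le : ∀ {μ : MeasureTheory.Measure ℂ} {P : MeasureTheory.Measure (Literature.Analysis.FunctionSpaces.PointConfig ℂ)} (M₀ : ℝ), Literature.Analysis.FunctionSpaces.IsPoissonPointProcess μ P → 0 ≤ M₀ → (∀ S : Set ℂ, MeasurableSet S → μ S ≤ ENNReal.ofReal M₀ * MeasureTheory.volume S) → ∀ (ρ ℓ τ : ℝ), 0 < τ → τ ≤ ℓ → ℓ ≤ ρ → P.real {c | ∃ (x p q a b : ℂ), p ∈ c ∧ q ∈ c ∧ a ∈ c ∧ b ∈ c ∧ p ≠ q ∧ a ≠ b ∧ a ≠ p ∧ a ≠ q ∧ b ≠ p ∧ b ≠ q ∧ x ∈ Metric.closedBall (0 : ℂ)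 ρ ∧ dist p x = dist q x ∧ dist p x ≤ ℓ ∧ dist a x = dist b x ∧ dist p x ≤ dist a x ∧ dist a x < dist p x + τ} ≤ (4 * ρ / τ + 1) ^ 2 * (4 * ℓ / τ) * ((36 * Real.pi * M₀ * τ * ℓ) ^ 4 / 24) := by
  intro μ P M₀ hP hM₀ hμ ρ ℓ τ hτ hτℓ hℓρ
  haveI := hP.isProbabilityMeasure
  obtain ⟨X, hXcard, hXcov⟩ := exists_finset_net_closedBall (Metric.closedBall (0 : ℂ) ρ) τ ρ hτ
    (hτℓ.trans hℓρ) subset_rfl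
  set B : ℝ := (36 * Real.pi * M₀ * τ * ℓ) ^ 4 / 24 with hB
  have hB0 : 0 ≤ B := by positivity
  have hJ := nt_card_range_le hτ hτℓ
  calc P.real {c | ∃ (x p q a b : ℂ), p ∈ c ∧ q ∈ c ∧ a ∈ c ∧ b ∈ c ∧ p ≠ q ∧ a ≠ b ∧
          a ≠ p ∧ a ≠ q ∧ b ≠ p ∧ b ≠ q ∧ x ∈ Metric.closedBall (0 : ℂ) ρ ∧ dist p x = dist q x ∧
          dist p x ≤ ℓ ∧ dist a x = dist b x ∧ dist p x ≤ dist a x ∧ dist a x < dist p x + τ}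
      ≤ P.real (⋃ x₀ ∈ X, ⋃ j ∈ Finset.range (⌊ℓ / τ⌋₊ + 1), {c : PointConfig ℂ |
          ((4 : ℕ) : ℕ∞) ≤ c.count (Metric.ball x₀ ((j : ℝ) * τ + 3 * τ) \
            Metric.closedBall x₀ ((j : ℝ) * τ - τ))}) :=
        measureReal_mono (nt_navelTie_subset X hτ hXcov) (measure_ne_top _ _)
    _ ≤ ∑ x₀ ∈ X, P.real (⋃ j ∈ Finset.range (⌊ℓ / τ⌋₊ + 1), {c : PointConfig ℂ |
          ((4 : ℕ) : ℕ∞) ≤ c.count (Metric.ball x₀ ((j : ℝ) * τ + 3 * τ) \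
            Metric.closedBall x₀ ((j : ℝ) * τ - τ))}) :=
        measureReal_biUnion_finset_le _ _
    _ ≤ ∑ x₀ ∈ X, ∑ j ∈ Finset.range (⌊ℓ / τ⌋₊ + 1), P.real {c : PointConfig ℂ |
          ((4 : ℕ) : ℕ∞) ≤ c.count (Metric.ball x₀ ((j : ℝ) * τ + 3 * τ) \
            Metric.closedBall x₀ ((j : ℝ) * τ - τ))} :=
        Finset.sum_le_sum fun x₀ _ => measureReal_biUnion_finset_le _ _
    _ ≤ ∑ x₀ ∈ X, ∑ j ∈ Finset.range (⌊ℓ / τ⌋₊ + 1), B :=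
        Finset.sum_le_sum fun x₀ _ => Finset.sum_le_sum fun j hj =>
          nt_annulus_term_le M₀ hP hM₀ hμ hτ hτℓ x₀ hj
    _ = X.card * ((Finset.range (⌊ℓ / τ⌋₊ + 1)).card * B) := by
        rw [Finset.sum_const, Finset.sum_const, nsmul_eq_mul, nsmul_eq_mul]
    _ ≤ (4 * ρ / τ + 1) ^ 2 * (4 * ℓ / τ * B) :=
        mul_le_mul hXcard (mul_le_mul_of_nonneg_right hJ hB0) (by positivity) (by positivity)
    _ = (4 * ρ / τ + 1) ^ 2 * (4 * ℓ / τ) * ((36 * Real.pi * M₀ * τ * ℓ) ^ 4 / 24) := by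
        rw [hB]; ring

end Summit.CriticalPhenomena.CardyFormulaZ2.Cruxes.VoronoiHubFromSmirnov.MoebiusExactDelaunayDilationWard

end
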